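import Summits.ResolutionOfSingularities.ResolutionOfSingularities.Theorems.FrobeniusClosingPatchingRelPerfectDepthWeightTwoBPieceStep
import Literature.AlgebraicGeometry.Resolution.CanonicalResolutionSmoothCentre
import Literature.AlgebraicGeometry.Resolution.BlowupDisjointCentreSplitting
import Literature.AlgebraicGeometry.Resolution.BoundarySplitting
import Literature.AlgebraicGeometry.Resolution.ReducedSubschemes
import Literature.AlgebraicGeometry.Resolution.SncSaturatedCentre
import Literature.AlgebraicGeometry.Resolution.ArithmeticalThreefoldsBlowupFormDimThree
import HarnessLib

/-!
# Crux `PatchingRelPerfect` (stmt-ResolutionOfSingularities-16161), chain W5.2 — TargetsF5J(R) T5-E «W₂B-maxweight»: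
# the GLOBAL TRANSPORT STATE and the CENTRE DATA of a piece

[OURS · L1 W5.2 · TargetsF5J(R) T5-E] Fact-free; NOT statements of the manuscript under review. The E-side producer of T5-E runs
along the CJS sequence and, inside each CJS step, along the connected pieces of the CJS centre. `StateIn 𝔟 D ℬ 𝒟` is the state it
carries on the current scheme `W` (regular): the factorisation `𝔟 = D · monomialIdeal ℬ`, the host `D` an effective Cartier divisor
EQUAL TO THE IDEAL OF ITS SUPPORT (reduced), the boundary sheaves `boundaryOf ℬ` with simple normal crossings and IRREDUCIBLE supports,
NONE OF THEM INSIDE THE HOST (support form of «the host has no boundary component»), the N-exponent list `𝒟` living on boundary sheaves,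
and the pointwise JOINT invariant (J#). `CentreIn D ℬ Z` is what a piece `Z` of a CJS centre brings: irreducible, `V(𝓘(Z))` regular,
`Z ⊆ Supp D`, the boundary snc with `𝓘(Z)` (res-type-019's P3 read piecewise), and CJS permissibility of `𝓘(Z)` for the reduced host at
every point of `Z`. `StateIn.pieceIn` assembles the single-piece datum `PieceIn` of `…DepthWeightTwoBPieceStep` (whence every input
clause of `IsWeightedSeqJR.cons`); `StateIn.init` is the initial state `(𝔟, D = 𝔟, [], [])` for a reduced locally principal `𝔟 ≠ 0`.

AI-written; AI review is weaker than expert review.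

## References
* E. Bierstone, D. Grigoriev, P. Milman, J. Włodarczyk, arXiv:1206.3090, Def. 3.1.3, §4 Step 2. [BierstoneGrigorievMilmanWlodarczyk2011]
* V. Cossart, U. Jannsen, S. Saito, LNM 2270 (2020), Thm. 1.4, Def. 3.1, Def. 4.1, (6.2). [CossartJannsenSaito2020]
* J. Kollár, *Lectures on Resolution of Singularities* (2007), 3.30.2, (3.111) Step 1. [Kollar2007]
-/

-- `Summit.<Summit>.<Sub>.Theorems` with `Sub = Summit` (single-conjunct summit, D-0017)
set_option linter.dupNamespace false

noncomputable section

open CategoryTheory CategoryTheory.Limits AlgebraicGeometry TopologicalSpace IsLocalRing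
open Literature.AlgebraicGeometry.Resolution Scheme.IdealSheafData

namespace Summit.ResolutionOfSingularities.ResolutionOfSingularities.Theorems

universe u

namespace WeightTwoB

open DepthSNC

variable {W : Scheme.{u}}

/-- [OURS · L1 W5.2] **The global transport state of T5-E** on the current (regular) scheme (see the module docstring).
[cite: BierstoneGrigorievMilmanWlodarczyk2011, Def. 3.1.3] [cite: Kollar2007, 3.30.2] -/
structure StateIn [IsLocallyNoetherian W] (𝔟 D : W.IdealSheafData) (ℬ 𝒟 : List (W.IdealSheafData × ℕ)) : Prop where
  /-- the ambient scheme is regular -/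
  regW : Scheme.IsRegular W
  /-- the factorisation host · boundary monomial -/
  fac : 𝔟 = D * monomialIdeal ℬ
  /-- the host is an effective Cartier divisor -/
  hostCartier : IsEffectiveCartier D
  /-- the host is reduced: it is the ideal of its support -/
  hostRad : D = vanishingIdeal D.support
  /-- the boundary sheaves have simple normal crossings -/
  sncB : HasSNC (boundaryOf ℬ)
  /-- the boundary sheaves have irreducible supports -/
  irred : ∀ p ∈ ℬ, IsIrreducible (p.1.support : Set W)
  /-- no boundary sheaf has its support inside the host (the host has no boundary component) -/
  free : ∀ p ∈ ℬ, ¬ ((p.1.support : Set W) ⊆ D.support)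
  /-- the N-exponent list lives on boundary sheaves -/
  sub𝒟 : ∀ p ∈ 𝒟, p.1 ∈ boundaryOf ℬ
  /-- (J#): at host points on an N-charged member, host and charged members are snc -/
  joint : ∀ x ∈ D.support, (∃ p ∈ 𝒟, 0 < p.2 ∧ x ∈ p.1.support) → SNCWithAt (D :: charged ℬ 𝒟) ⊤ x

/-- [OURS · L1 W5.2] **The centre data of one piece** `Z` of a CJS centre, relative to the host `D` and the boundary `ℬ`
(see the module docstring). [cite: CossartJannsenSaito2020, Def. 3.1, Def. 4.1, (6.2)] -/
structure CentreIn [IsLocallyNoetherian W] (D : W.IdealSheafData) (ℬ : List (W.IdealSheafData × ℕ)) (Z : Closeds W) : Prop where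
  /-- the piece is irreducible -/
  irred : IsIrreducible (Z : Set W)
  /-- the piece is a regular closed subscheme -/
  regZ : Scheme.IsRegular (vanishingIdeal Z).subscheme
  /-- the piece lies on the host -/
  subZ : (Z : Set W) ⊆ D.support
  /-- the boundary has simple normal crossings with the piece -/
  sncZ : HasSNCWith (boundaryOf ℬ) (vanishingIdeal Z)
  /-- CJS permissibility of `𝓘(Z)` for the reduced zero-scheme of the host, at every point of `Z` -/
  perm : ∀ z ∈ (Z : Set W),
    ((stalkIdeal (vanishingIdeal Z) z).map (Ideal.Quotient.mk (stalkIdeal (vanishingIdeal D.support) z))).IsPermissible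

namespace CentreIn

variable [IsLocallyNoetherian W] {D : W.IdealSheafData} {ℬ : List (W.IdealSheafData × ℕ)} {Z : Closeds W}

/-- An irreducible closed piece has a generic point. [folklore] -/
theorem exists_isGenericPoint (Γ : CentreIn D ℬ Z) : ∃ η : W, IsGenericPoint η (Z : Set W) :=
  QuasiSober.sober Γ.irred Z.isClosed

end CentreIn

namespace StateIn

variable [IsLocallyNoetherian W] {𝔟 D : W.IdealSheafData} {ℬ 𝒟 : List (W.IdealSheafData × ℕ)} (S : StateIn 𝔟 D ℬ 𝒟)
include S

/-- **State + centre data + generic point = the single-piece datum** of `…DepthWeightTwoBPieceStep`. [folklore] -/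
theorem pieceIn {Z : Closeds W} (Γ : CentreIn D ℬ Z) {η : W} (hη : IsGenericPoint η (Z : Set W)) :
    PieceIn 𝔟 D ℬ 𝒟 Z η where
  regW := S.regW
  fac := S.fac
  hostCartier := S.hostCartier
  sncB := S.sncB
  sub𝒟 := S.sub𝒟
  joint := S.joint
  gen := hη
  regZ := Γ.regZ
  subZ := Γ.subZ
  sncZ := Γ.sncZ
  perm := fun _ => Γ.perm

/-- A boundary sheaf is the ideal of its support. [folklore] -/
theorem eq_vanishingIdeal_of_mem {B : W.IdealSheafData} (hB : B ∈ boundaryOf ℬ) : B = vanishingIdeal B.support :=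
  (S.sncB.vanishingIdeal_support hB).symm

/-- A boundary sheaf is an effective Cartier divisor. [folklore] -/
theorem isEffectiveCartier_of_mem {B : W.IdealSheafData} (hB : B ∈ boundaryOf ℬ) : IsEffectiveCartier B :=
  S.sncB.isEffectiveCartier_of_mem hB

/-- A boundary sheaf containing the host in its support would contain it: support form ⇒ ideal form of «no boundary
component». [folklore] -/
theorem not_host_le (p : W.IdealSheafData × ℕ) (hp : p ∈ ℬ) : ¬ D ≤ p.1 := fun h =>
  S.free p hp (support_antitone h)

/-- The support of a boundary sheaf is not contained in the piece `Z ⊆ Supp D`. [folklore] -/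
theorem not_support_subset_of_subset {p : W.IdealSheafData × ℕ} (hp : p ∈ ℬ) {Z : Set W} (hZ : Z ⊆ D.support) :
    ¬ ((p.1.support : Set W) ⊆ Z) := fun h => S.free p hp (h.trans hZ)

end StateIn

/-! ## The initial state -/

/-- `monomialIdeal [] = ⊤`. [folklore] -/
theorem monomialIdeal_nil : monomialIdeal ([] : List (W.IdealSheafData × ℕ)) = ⊤ := by
  simp [monomialIdeal, Scheme.IdealSheafData.one_eq_top]

/-- `charged [] [] = []`. [folklore] -/
theorem charged_nil : charged ([] : List (W.IdealSheafData × ℕ)) [] = [] := rfl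

/-- **The initial state** `(𝔟, D = 𝔟, [], [])` for a non-zero locally principal `𝔟` with reduced zero scheme on a regular
scheme. [cite: CossartJannsenSaito2020, Thm. 1.4] -/
theorem StateIn.init [IsIntegral W] [IsLocallyNoetherian W] (hW : Scheme.IsRegular W) {𝔟 : W.IdealSheafData} (h𝔟 : 𝔟 ≠ ⊥)
    (hlp : IsLocallyPrincipal 𝔟) (hred : IsReduced 𝔟.subscheme) : StateIn 𝔟 𝔟 [] [] where
  regW := hW
  fac := by rw [monomialIdeal_nil, Scheme.IdealSheafData.mul_top]
  hostCartier := hlp.isEffectiveCartier_of_ne_bot h𝔟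
  hostRad := by
    rw [Scheme.IdealSheafData.vanishingIdeal_support, (isReduced_subscheme_iff_radical_eq 𝔟).mp hred]
  sncB := by
    simpa [boundaryOf] using hasSNCWith_nil_of_isRegular hW (isRegular_subscheme_top (X := W))
  irred := fun p hp => by simp at hp
  free := fun p hp => by simp at hp
  sub𝒟 := fun p hp => by simp at hp
  joint := fun x _ h => by obtain ⟨p, hp, -⟩ := h; simp at hp

end WeightTwoB

end Summit.ResolutionOfSingularities.ResolutionOfSingularities.Theorems

end
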